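import Summits.BirchSwinnertonDyer.BirchSwinnertonDyer.Theorems.ClassRecordThreeEulerHalvesAtThreeCartanTransportHull
import Summits.BirchSwinnertonDyer.BirchSwinnertonDyer.Theorems.ClassRecordThreeEulerHalvesAtThreeCartanCoverMapDegree
import Literature.NumberTheory.Automorphic.ShimuraCurveMapDegreeProofs
import HarnessLib

/-!
# Crux NUM `CartanOnePlaceDegreeLawAtThree` (item 24801), line `lattice` — towards the discharge of (ISO) for `D > 1`: the Cartan-level group `X.Gamma = ι(O¹)` acts
# PROPERLY DISCONTINUOUSLY on `ℍ` and is COCOMPACT (finite index in the hull group `ι(O₀¹)`)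

Seat `bsd-stepL-tam3-p1` g27 (LEAD of crux 24801; `--supports stmt-BirchSwinnertonDyer-24801 --as helper`). For `X : CartanLevelCurveData D M C`:
* `cartanGamma_finite_smul_inter` — from the hull datum `X.toShimuraCurveData` (tree `ShimuraCurveData.properlyDiscontinuousSMul_Gamma`, bsd-idea-10 g17 H0
  `Hull.exists_isHypFundamentalDomain_hull`) and `X.Gamma ≤ ι(O₀¹)`.
* `exists_finset_leftCosets` — FINITE INDEX: finitely many `γ_v ∈ ι(O₀¹)` with `ι(O₀¹) = ⋃_v γ_v·X.Gamma`. Proof without residue maps: two norm-one units `u, u'` of `O₀`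
  with the same image in `O₀ ∕ N·O₀` (`N = ∏_C p`; coordinates modulo `N` in a `ℤ`-basis of `O₀`) satisfy `u⁻¹u' − 1 = u⁻¹(u' − u) ∈ N·O₀ ⊆ X.O` (`X.smul_mem`), so
  `u⁻¹u' ∈ O¹`; the coordinate map has finite range.
* `cartanGamma_exists_dist_le_of_one_lt` (`D > 1`) — COCOMPACTNESS: one closed ball meets every `X.Gamma`-orbit (the hull's ball, tree
  `ShimuraCurveData.exists_forall_exists_smul_mem_closedBall`, translated by the finitely many `γ_v⁻¹`).
With `MapDegree.exists_deg_of_hasPeriodsIn_of_cocompact` (p734907) this gives the degree of a non-zero weight-two form with lattice periods on a Cartan-level curve, `D > 1`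
(`cartanGamma_finite_badClasses_of_one_lt`; statements phrased so as not to shadow the `ShimuraCurveData` twins). Nothing about NUM or any curve is proved; BSD is proved for no curve. [cite: VignerasLNM800, Ch. IV §1 Thm. 1.1] [cite: KohenPacetti2016, §2]
-/

set_option linter.dupNamespace false
set_option autoImplicit false

noncomputable section

open scoped MatrixGroups ModularForm Topology Pointwise
open UpperHalfPlane Filter Set Function

namespace Summit.BirchSwinnertonDyer.BirchSwinnertonDyer.Theorems.CartanCover.MapDegree

open Literature.NumberTheory.Automorphic
open Summit.BirchSwinnertonDyer.BirchSwinnertonDyer.Theorems.CartanTransport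

variable {D M : ℕ} {C : Finset ℕ} (X : CartanLevelCurveData D M C)

/-! ## §1 Proper discontinuity -/

/-- **`X.Gamma` acts properly discontinuously on `ℍ`** (a subgroup of the hull group `ι(O₀¹)`, which does), in the unfolded form: for compact `K, L ⊆ ℍ` only finitely
many `γ ∈ X.Gamma` have `γK ∩ L ≠ ∅` (use `(Subgroup.properlyDiscontinuousSMul_iff _).mpr`). [cite: VignerasLNM800, Ch. IV §1 Thm. 1.1 (1)] -/
theorem cartanGamma_finite_smul_inter {K L : Set ℍ} (hK : IsCompact K) (hL : IsCompact L) :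
    {γ : GL (Fin 2) ℝ | γ ∈ X.Gamma ∧ (γ • K ∩ L).Nonempty}.Finite := by
  obtain ⟨fd₀, h₀⟩ := Hull.exists_isHypFundamentalDomain_hull X
  have hH : ProperlyDiscontinuousSMul (X.toShimuraCurveData fd₀ h₀).Gamma ℍ := (X.toShimuraCurveData fd₀ h₀).properlyDiscontinuousSMul_Gamma
  rw [Subgroup.properlyDiscontinuousSMul_iff] at hH
  refine (hH hK hL).subset ?_
  rintro γ ⟨hγ, hKL⟩
  exact ⟨Hull.gamma_le_hullUnits X hγ, hKL⟩

/-! ## §2 Finite index of `X.Gamma` in the hull group -/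

/-- The product of the Cartan primes is non-zero. -/
theorem prod_cartanPrimes_ne_zero (X : CartanLevelCurveData D M C) : (∏ q ∈ C, q : ℕ) ≠ 0 :=
  Finset.prod_ne_zero_iff.mpr fun q hq => (X.coprime q hq).1.ne_zero

/-- **Finitely many left cosets**: there is a finite set of hull units `γ_v ∈ ι(O₀¹)` such that every hull unit lies in some `γ_v · X.Gamma`. -/
theorem exists_finset_leftCosets :
    ∃ T : Finset (GL (Fin 2) ℝ), (∀ t ∈ T, t ∈ normOneUnits X.ι X.isEichlerOrder.isOrder) ∧
      ∀ γ ∈ normOneUnits X.ι X.isEichlerOrder.isOrder, ∃ t ∈ T, t⁻¹ * γ ∈ X.Gamma := by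
  classical
  have hO₀ := X.isEichlerOrder.isOrder
  set N : ℕ := ∏ q ∈ C, q with hNdef
  have hN : N ≠ 0 := prod_cartanPrimes_ne_zero X
  haveI : NeZero N := ⟨hN⟩
  -- a `ℤ`-basis of `O₀` and coordinates modulo `N`
  obtain ⟨b⟩ := hO₀.isFullLattice.nonempty_basis_fin_four
  let coord : X.O₀ → (Fin 4 → ZMod N) := fun x i => ((b.repr x i : ℤ) : ZMod N)
  -- two elements with the same coordinates mod `N` differ by an element of `N • O₀`
  have hcoord : ∀ x y : X.O₀, coord x = coord y → ∃ z : X.O₀, (x : X.B) - y = (N : ℤ) • (z : X.B) := by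
    intro x y hxy
    have hdiv : ∀ i, (N : ℤ) ∣ b.repr x i - b.repr y i := by
      intro i
      have h := congr_fun hxy i
      exact (ZMod.intCast_eq_intCast_iff_dvd_sub _ _ _).mp h.symm
    choose c hc using hdiv
    refine ⟨Finsupp.linearCombination ℤ b (Finsupp.equivFunOnFinite.symm c), ?_⟩
    have hrepr : b.repr (x - y) = (N : ℤ) • Finsupp.equivFunOnFinite.symm c := by
      ext i
      simp [hc i]
    have hxmy : x - y = (N : ℤ) • Finsupp.linearCombination ℤ b (Finsupp.equivFunOnFinite.symm c) := by
      apply b.repr.injective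
      rw [hrepr, map_zsmul, b.repr_linearCombination]
    have := congrArg (fun v : X.O₀ => (v : X.B)) hxmy
    simpa using this
  -- lifts of hull units to `O₀`
  have hlift : ∀ γ ∈ normOneUnits X.ι X.isEichlerOrder.isOrder, ∃ u : X.O₀, X.ι (u : X.B) = (γ : Matrix (Fin 2) (Fin 2) ℝ) := by
    rintro γ ⟨⟨x, hx, hxγ⟩, -, -⟩
    exact ⟨⟨x, hx⟩, hxγ⟩
  choose! lift hliftι using hlift
  -- the finite set of values and representatives
  have hfin : (Set.range fun γ : normOneUnits X.ι X.isEichlerOrder.isOrder => coord (lift γ)).Finite := Set.toFinite _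
  have hrep : ∀ v ∈ Set.range (fun γ : normOneUnits X.ι X.isEichlerOrder.isOrder => coord (lift γ)),
      ∃ t : GL (Fin 2) ℝ, t ∈ normOneUnits X.ι X.isEichlerOrder.isOrder ∧ coord (lift t) = v := by
    rintro v ⟨γ, rfl⟩
    exact ⟨γ, γ.2, rfl⟩
  choose! rep hrepmem hrepcoord using hrep
  refine ⟨hfin.toFinset.image rep, ?_, ?_⟩
  · intro t ht
    obtain ⟨v, hv, rfl⟩ := Finset.mem_image.mp ht
    exact hrepmem v (hfin.mem_toFinset.mp hv)
  · intro γ hγ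
    set v := coord (lift γ) with hvdef
    have hv : v ∈ Set.range (fun γ : normOneUnits X.ι X.isEichlerOrder.isOrder => coord (lift γ)) := ⟨⟨γ, hγ⟩, rfl⟩
    refine ⟨rep v, Finset.mem_image.mpr ⟨v, hfin.mem_toFinset.mpr hv, rfl⟩, ?_⟩
    -- `t := rep v`, `u := lift t`, `u' := lift γ` have the same coordinates mod `N`
    have ht := hrepmem v hv
    have hc : coord (lift (rep v)) = coord (lift γ) := by rw [hrepcoord v hv]
    obtain ⟨z, hz⟩ := hcoord _ _ hc
    -- the inverse of `t` in `O₀`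
    obtain ⟨⟨xt, hxt, hxtι⟩, ⟨yt, hyt, hytι⟩, hdet_t⟩ := ht
    obtain ⟨⟨xγ, hxγ, hxγι⟩, ⟨yγ, hyγ, hyγι⟩, hdet_γ⟩ := hγ
    have hut : (lift (rep v) : X.B) = xt := X.ι_injective (by rw [hliftι _ ⟨⟨xt, hxt, hxtι⟩, ⟨yt, hyt, hytι⟩, hdet_t⟩, hxtι])
    have huγ : (lift γ : X.B) = xγ := X.ι_injective (by rw [hliftι _ ⟨⟨xγ, hxγ, hxγι⟩, ⟨yγ, hyγ, hyγι⟩, hdet_γ⟩, hxγι])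
    -- `yt * xt = 1` and `xt * yt = 1` (from `ι`)
    have hyx : yt * xt = 1 := X.ι_injective (by rw [map_mul, hytι, hxtι, ← Units.val_mul, inv_mul_cancel, Units.val_one, map_one])
    have hxy : xt * yt = 1 := X.ι_injective (by rw [map_mul, hytι, hxtι, ← Units.val_mul, mul_inv_cancel, Units.val_one, map_one])
    -- `t⁻¹ γ = ι(yt * xγ)` with `yt * xγ ∈ O`: `yt * xγ - 1 = yt * (xγ - xt) = -N • (yt * z) ∈ O`
    have hmemO : yt * xγ ∈ X.O := by
      have e : yt * xγ = 1 + (-(yt * ((N : ℤ) • (z : X.B)))) := by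
        have : (xt : X.B) - xγ = (N : ℤ) • (z : X.B) := by rw [← hut, ← huγ]; exact hz
        calc yt * xγ = yt * xt - yt * (xt - xγ) := by noncomm_ring
          _ = 1 + (-(yt * ((N : ℤ) • (z : X.B)))) := by rw [hyx, this]; abel
      rw [e]
      refine X.O.add_mem X.isOrder.one_mem (X.O.neg_mem ?_)
      rw [mul_smul_comm]
      have hz' : ((∏ q ∈ C, q : ℕ) : ℤ) • (yt * (z : X.B)) ∈ X.O := X.smul_mem _ (hO₀.mul_mem yt hyt _ z.2)
      exact hz'
    have hmemO' : yγ * xt ∈ X.O := by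
      -- the inverse: `yγ * xt - 1 = yγ * (xt - xγ) = N • (yγ * z)`
      have hyγx : yγ * xγ = 1 := X.ι_injective (by rw [map_mul, hyγι, hxγι, ← Units.val_mul, inv_mul_cancel, Units.val_one, map_one])
      have e : yγ * xt = 1 + yγ * ((N : ℤ) • (z : X.B)) := by
        have : (xt : X.B) - xγ = (N : ℤ) • (z : X.B) := by rw [← hut, ← huγ]; exact hz
        calc yγ * xt = yγ * xγ + yγ * (xt - xγ) := by noncomm_ring
          _ = 1 + yγ * ((N : ℤ) • (z : X.B)) := by rw [hyγx, this]
      rw [e]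
      refine X.O.add_mem X.isOrder.one_mem ?_
      rw [mul_smul_comm]
      exact X.smul_mem _ (hO₀.mul_mem yγ hyγ _ z.2)
    refine ⟨⟨yt * xγ, hmemO, by rw [map_mul, hytι, hxγι, Units.val_mul]⟩, ⟨yγ * xt, hmemO', ?_⟩, ?_⟩
    · rw [map_mul, hyγι, hxtι, mul_inv_rev, inv_inv, Units.val_mul]
    · rw [map_mul, map_inv, hdet_t, hdet_γ, inv_one, one_mul]

/-! ## §3 Cocompactness (`D > 1`) -/

/-- **One closed ball meets every `X.Gamma`-orbit** (`D > 1`): the hull's ball (tree, Vignéras IV Thm. 1.1 for the division algebra) translated by the inverses of the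
finitely many coset representatives. [cite: VignerasLNM800, Ch. IV §1 Thm. 1.1] -/
theorem cartanGamma_exists_dist_le_of_one_lt (hD : 1 < D) :
    ∃ ρ : ℝ, ∀ z : ℍ, ∃ γ ∈ X.Gamma, dist (γ • z) UpperHalfPlane.I ≤ ρ := by
  classical
  simp only [← Metric.mem_closedBall]
  obtain ⟨fd₀, h₀⟩ := Hull.exists_isHypFundamentalDomain_hull X
  obtain ⟨ρ₀, hρ₀⟩ := (X.toShimuraCurveData fd₀ h₀).exists_forall_exists_smul_mem_closedBall hD
  obtain ⟨T, hT, hcos⟩ := exists_finset_leftCosets X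
  -- each translate `t⁻¹ • closedBall I ρ₀` is bounded; take a common radius
  have hbd : ∀ t ∈ T, ∃ r : ℝ, ∀ z ∈ Metric.closedBall UpperHalfPlane.I ρ₀, t⁻¹ • z ∈ Metric.closedBall UpperHalfPlane.I r := by
    intro t _
    have hc : IsCompact ((fun z : ℍ => t⁻¹ • z) '' Metric.closedBall UpperHalfPlane.I ρ₀) :=
      (isCompact_closedBall _ _).image (continuous_const_smul _)
    obtain ⟨r, hr⟩ := hc.isBounded.subset_closedBall UpperHalfPlane.I
    exact ⟨r, fun z hz => hr ⟨z, hz, rfl⟩⟩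
  choose! r hr using hbd
  refine ⟨T.sup' ?_ r ⊔ 0, fun z => ?_⟩
  · -- `T` is non-empty: the identity hull unit has a representative
    obtain ⟨t, ht, -⟩ := hcos 1 (one_mem _)
    exact ⟨t, ht⟩
  · obtain ⟨γ₀, hγ₀, hz⟩ := hρ₀ z
    have hγ₀' : γ₀ ∈ normOneUnits X.ι X.isEichlerOrder.isOrder := hγ₀
    obtain ⟨t, ht, htγ⟩ := hcos γ₀ hγ₀'
    refine ⟨t⁻¹ * γ₀, htγ, ?_⟩
    rw [mul_smul]
    have h1 := hr t ht (γ₀ • z) hz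
    have hle : r t ≤ T.sup' ⟨t, ht⟩ r ⊔ 0 := le_sup_of_le_left (Finset.le_sup' r ht)
    exact Metric.closedBall_subset_closedBall hle h1

/-- **DEGREE of a non-zero weight-two form on a Cartan-level curve, `D > 1`**: for `h ∈ S₂(X.Gamma)`, `h ≠ 0`, with periods in `Λ_L`, there is `d ≥ 1` such that all but
finitely many classes `c ∈ ℂ∕Λ_L` are hit by exactly `d` orbits. [cite: FarkasKra1992, Prop. I.1.6] -/
theorem cartanGamma_finite_badClasses_of_one_lt (hD : 1 < D) (h : CuspForm X.Gamma 2) (hh : (⇑h : ℍ → ℂ) ≠ 0)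
    (L : PeriodPair) (hper : HasPeriodsIn X.Gamma h (L.lattice : Set ℂ)) (τ₀ : ℍ) :
    ∃ d : ℕ, {c : ℂ ⧸ L.lattice.toAddSubgroup |
        Nat.card {y : MulAction.orbitRel.Quotient X.Gamma ℍ // ∃ τ : ℍ,
          (Quotient.mk _ τ : MulAction.orbitRel.Quotient X.Gamma ℍ) = y ∧
            ((segmentIntegral h τ₀ τ : ℂ) : ℂ ⧸ L.lattice.toAddSubgroup) = c} ≠ d}.Finite ∧ 0 < d := by
  haveI : ProperlyDiscontinuousSMul X.Gamma ℍ := (Subgroup.properlyDiscontinuousSMul_iff _).mpr fun hK hL => cartanGamma_finite_smul_inter X hK hL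
  have hcoc : ∃ ρ : ℝ, ∀ z : ℍ, ∃ γ ∈ X.Gamma, γ • z ∈ Metric.closedBall UpperHalfPlane.I ρ := by
    simpa only [Metric.mem_closedBall] using cartanGamma_exists_dist_le_of_one_lt X hD
  obtain ⟨d, hd, hfin⟩ := exists_deg_of_hasPeriodsIn_of_cocompact hcoc h hh L hper τ₀
  exact ⟨d, hfin, hd⟩

end Summit.BirchSwinnertonDyer.BirchSwinnertonDyer.Theorems.CartanCover.MapDegree

end
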